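import Summits.NavierStokesRegularity.FluidComputer.FamilySymmetry
import Mathlib.Analysis.SpecialFunctions.Pow.Real
import HarnessLib

/-!
# Fluid computer — the `√ν·Z` CROSSING dictionary of the Reynolds ladder, typed (rung R3 pass 2,
# RULING R40; idea-2's pre-registered test P98; pub-fluidc-lit gen 40)

HONEST FRAMING (cell `pub-fluidc`, verbatim): *low prior, high value-of-information experiment on Tao's
machine paradigm; NOT a claim that NS blows up.*  Theorem side of the cell; nothing here is evidence of
blow-up, and nothing beyond the truncated (Galerkin) Navier–Stokes system both DNS engines step is used.

WHAT IS READ ON THE LADDER.  R40 runs ONE field `u₀` at viscosities `ν = ν₀/ρ` (rung `ρ`).  idea-2's P98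
(cell file `PREREG-NEG-REAXIS-G10.md` §2h) reads the pairwise CROSSING TIMES of the curves
`B_ρ(t) = √(ν₀/ρ) · Z_ρ(t)` (`Z` = enstrophy), after the printed observation that for a trefoil knot and
for anti-parallel tubes run at several viscosities all `√ν Z_ν(t)` cross at one `ν`-independent time
`t_x` (R. M. Kerr, J. Fluid Mech. 839 (2018) R2; J. Fluid Mech. (2025) doi:10.1017/jfm.2025.10513 — cell
file LITERATURE.md §A22.21e/§A22.22/§A22.23 holds the verbatim statements; they are CONTEXT here, not
hypotheses of any lemma).  This leaf types the bookkeeping those words use, and nothing else: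

* §1 `sqrt_mul_eq_dissipation_div_sqrt` — the currency identity `√ν·Z = ε/√ν` for `ε = ν Z` (the tree's
  dissipation is `2ν Z_S`; the factor `2` is carried explicitly in `sqrt_mul_truncEnstrophy_eq`);
  `dissipation_powerlaw_iff` — at fixed circulation `Γ` with `ν = Γ/Re`, "`ε = C·Re^{-1/2}`" and
  "`√ν·Z = C/√Γ`" are THE SAME statement (so a printed `ε_max ∝ Re^{-1/2}` law and a printed
  "`√ν Z` reaches a `ν`-independent level" law agree on the amplitude and can differ only on clocks);
* §2 `sqrt_mul_truncEnstrophy_ladder`, `dissipation_ladder` — under the exact similarity of the tree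
  (`FamilySymmetry.eq_scaleTime_visc`: `V` = the unforced run at viscosity `r ν` from `r·û(0)` is
  `t ↦ r·û(r t)`) the `B`-currency is NOT invariant: `√(rν)·Z_T(V t) = r²√r · √ν·Z_T(û(r t))` and
  `(rν)·Z_T(V t) = r³ · ν·Z_T(û(r t))`; so the amplitude-scaled sibling of a rung (p1's AX leg) is not an
  independent datum for a crossing test — mapped back by `t ↦ r t` it IS the rung `ρ = r`;
* §3 the POWER-LAW FAMILY rationale registered by idea-2 (§2h-H: "under `Z_ρ(t) = Z₁(t)·ρ^{φ(t)}` with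
  `ρ`-independent `φ` every pair crosses at the same instant (`φ = ½`); fan-out exists only through `φ`'s
  `ρ`-dependence"), with `B_ρ(t) = √(ν₀/ρ)·(Z₁(t)·ρ^{φ(t)})` written out: `powerFamilyB_eq_iff` (two rungs agree at `t` iff
  `φ t = 1/2`, given `Z₁ t ≠ 0`), `powerFamilyB_common_crossing` (then ALL pairs agree at `t`),
  `powerFamilyB_crossing_transfer` (if one pair of distinct rungs crosses at `t`, every pair does — the
  contrapositive is "pairwise fan-out ⇒ `φ` depends on `ρ`"), and the ORDER of the curves away from a
  crossing, `powerFamilyB_lt_iff` (for `ρ < ρ'` and `Z₁ t > 0`: `B_ρ(t) < B_ρ'(t)` iff `1/2 < φ t` — the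
  less viscous rung is above exactly where the enstrophy grows faster than `√Re`).

Pure real bookkeeping plus two lines on the tree's Galerkin objects; 0 sorry, no definitions, no named facts
(D-0026).
-/

noncomputable section

namespace Summit.NavierStokesRegularity.FluidComputer.EnstrophyCrossing

open Literature.Analysis.FluidPDE.FluidComputer
open Literature.Analysis.FluidPDE.FluidComputer.ShellTransfer
open Literature.Analysis.FluidPDE.FluidComputer.ShellTransfer.TaylorGreenHat
open Summit.NavierStokesRegularity.FluidComputer.FamilySymmetry
open Real

/-! ## §1 Currencies: `√ν·Z = ε/√ν`, and the `Re^{-1/2}` dissipation law IS the `√ν Z` level law -/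

/-- The `B`-currency is the dissipation over `√ν`: for `ν > 0`, `√ν · Z = (ν Z)/√ν`. -/
theorem sqrt_mul_eq_dissipation_div_sqrt {ν : ℝ} (hν : 0 < ν) (Z : ℝ) :
    sqrt ν * Z = ν * Z / sqrt ν := by
  have hs : sqrt ν ≠ 0 := (sqrt_pos.2 hν).ne'
  rw [eq_div_iff hs, mul_assoc, mul_comm Z, ← mul_assoc, mul_self_sqrt hν.le]

/-- The same in the tree's convention `ε_S = 2ν Z_S` for the truncated system:
`√ν · Z_S(U) = ε_S / (2√ν)`. -/
theorem sqrt_mul_truncEnstrophy_eq {ν : ℝ} (hν : 0 < ν) (U : FourierVelocity)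
    (S : Finset (Fin 3 → ℤ)) :
    sqrt ν * truncEnstrophy U S = 2 * ν * truncEnstrophy U S / (2 * sqrt ν) := by
  rw [mul_assoc, mul_div_mul_left _ _ (two_ne_zero' ℝ)]
  exact sqrt_mul_eq_dissipation_div_sqrt hν _

/-- With `ν = Γ/Re` (`Γ, Re > 0`): `√ν = √Γ · Re^{-1/2}`. -/
theorem sqrt_visc_of_reynolds (Γ : ℝ) {Re : ℝ} (hRe : 0 < Re) :
    sqrt (Γ / Re) = sqrt Γ * Re ^ (-(1 / 2 : ℝ)) := by
  rw [sqrt_div' Γ hRe.le, rpow_neg hRe.le, sqrt_eq_rpow Re, div_eq_mul_inv]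

/-- **The two printed amplitude laws coincide.**  At fixed circulation `Γ > 0`, Reynolds number
`Re > 0`, viscosity `ν = Γ/Re` and dissipation `ε = ν Z`:
`ε = C · Re^{-1/2}` iff `√ν · Z = C/√Γ`.  (Read along a ladder `Re ↦ Z(Re)`: "the peak dissipation
scales as `Re^{-1/2}`" and "`√ν Z` reaches a `ν`-independent level" are the same statement, both
equivalent to `Z ∝ Re^{1/2}`; such laws can therefore differ only in WHEN the level is reached.) -/
theorem dissipation_powerlaw_iff {Γ Re C Z : ℝ} (hΓ : 0 < Γ) (hRe : 0 < Re) :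
    Γ / Re * Z = C * Re ^ (-(1 / 2 : ℝ)) ↔ sqrt (Γ / Re) * Z = C / sqrt Γ := by
  have hν : 0 < Γ / Re := div_pos hΓ hRe
  have hsν : sqrt (Γ / Re) ≠ 0 := (sqrt_pos.2 hν).ne'
  have hsΓ : 0 < sqrt Γ := sqrt_pos.2 hΓ
  rw [sqrt_mul_eq_dissipation_div_sqrt hν, div_eq_iff hsν, sqrt_visc_of_reynolds Γ hRe,
    ← mul_assoc, div_mul_cancel₀ C hsΓ.ne']

/-- Equivalently, in enstrophy currency (`√Re = Re^{1/2}`): `√ν · Z = C/√Γ` iff `Z = C/Γ · √Re`. -/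
theorem sqrt_level_iff_enstrophy_law {Γ Re C Z : ℝ} (hΓ : 0 < Γ) (hRe : 0 < Re) :
    sqrt (Γ / Re) * Z = C / sqrt Γ ↔ Z = C / Γ * sqrt Re := by
  have hsΓ : 0 < sqrt Γ := sqrt_pos.2 hΓ
  have hsR : 0 < sqrt Re := sqrt_pos.2 hRe
  have hΓ2 : sqrt Γ * sqrt Γ = Γ := mul_self_sqrt hΓ.le
  rw [sqrt_div' Γ hRe.le, div_mul_eq_mul_div, div_eq_iff hsR.ne', ← mul_right_inj' hsΓ.ne',
    ← mul_assoc, hΓ2, ← mul_assoc, mul_div_cancel₀ C hsΓ.ne', div_mul_eq_mul_div, eq_div_iff hΓ.ne',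
    mul_comm Z Γ]

/-! ## §2 The `B`-currency along the exact similarity (`FamilySymmetry.eq_scaleTime_visc`) -/

variable {U V : ℝ → FourierVelocity} {S : Finset (Fin 3 → ℤ)} {c c' : ℝ → (Fin 3 → ℤ) → ℂ} {ν r : ℝ}

/-- **`√ν·Z` is NOT similarity-invariant.**  `û` = the rung (unforced Galerkin run, viscosity `ν`),
`V` = the unforced run with viscosity `r ν` from `r·û(0)` (`r ≥ 0`), both supported in `S`: on every mode
set `T`, `√(rν) · Z_T(V t) = (r² √r) · (√ν · Z_T(û(r t)))`.  Hence the amplitude-scaled sibling of a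
rung, read in `B`-currency, is the rung's own curve dilated by `t ↦ r t` and multiplied by `r^{5/2}`:
it supplies no independent crossing. -/
theorem sqrt_mul_truncEnstrophy_ladder (hU : IsGalerkinSolution U S ν c fun _ _ _ => 0)
    (hs : IsSupportedOn U S) (hV : IsGalerkinSolution V S (r * ν) c' fun _ _ _ => 0)
    (hsV : IsSupportedOn V S) (h0 : V 0 = scale r (U 0)) (hr : 0 ≤ r) (t : ℝ)
    (T : Finset (Fin 3 → ℤ)) :
    sqrt (r * ν) * truncEnstrophy (V t) T
      = (r ^ 2 * sqrt r) * (sqrt ν * truncEnstrophy (U (r * t)) T) := by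
  rw [(truncEnstrophy_scaleTime_visc hU hs hV hsV h0 t T).1, sqrt_mul hr]
  ring

/-- The dissipation along the similarity: `(rν) · Z_T(V t) = r³ · (ν · Z_T(û(r t)))` (cell LITERATURE.md
§A22.21a: "`ε = 2νZ ↦ r³·ε(rt)`"). -/
theorem dissipation_ladder (hU : IsGalerkinSolution U S ν c fun _ _ _ => 0)
    (hs : IsSupportedOn U S) (hV : IsGalerkinSolution V S (r * ν) c' fun _ _ _ => 0)
    (hsV : IsSupportedOn V S) (h0 : V 0 = scale r (U 0)) (t : ℝ) (T : Finset (Fin 3 → ℤ)) :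
    r * ν * truncEnstrophy (V t) T = r ^ 3 * (ν * truncEnstrophy (U (r * t)) T) := by
  rw [(truncEnstrophy_scaleTime_visc hU hs hV hsV h0 t T).1]
  ring

/-! ## §3 The power-law family: common crossing iff `φ = 1/2`; fan-out needs a `ρ`-dependent exponent -/

section PowerFamily

variable {ν₀ ρ ρ' t : ℝ} {Z₁ φ : ℝ → ℝ}

/-! The `B`-observable of the power-law family `Z_ρ(t) = Z₁(t) · ρ^{φ(t)}` run at viscosity `ν₀/ρ` is
written out in every statement as `B_ρ(t) = √(ν₀/ρ) · (Z₁(t) · ρ^{φ(t)})` (no definition is introduced). -/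

/-- Closed form: for `ρ > 0`, `B_ρ(t) = √(ν₀/ρ)·(Z₁(t)·ρ^{φ(t)}) = √ν₀ · Z₁(t) · ρ^{φ(t) − 1/2}`. -/
theorem powerFamilyB_eq_rpow (hρ : 0 < ρ) (t : ℝ) :
    sqrt (ν₀ / ρ) * (Z₁ t * ρ ^ φ t) = sqrt ν₀ * Z₁ t * ρ ^ (φ t - 1 / 2) := by
  have hp : ρ ^ (1 / 2 : ℝ) ≠ 0 := (rpow_pos_of_pos hρ _).ne'
  rw [sqrt_div' ν₀ hρ.le, sqrt_eq_rpow ρ, rpow_sub hρ]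
  field_simp

/-- **Two distinct rungs agree at `t` iff `φ t = 1/2`** (`ν₀ > 0`, `Z₁ t ≠ 0`, `ρ ≠ ρ'` positive). -/
theorem powerFamilyB_eq_iff (hν : 0 < ν₀) (hρ : 0 < ρ) (hρ' : 0 < ρ') (hne : ρ ≠ ρ')
    (hZ : Z₁ t ≠ 0) :
    sqrt (ν₀ / ρ) * (Z₁ t * ρ ^ φ t) = sqrt (ν₀ / ρ') * (Z₁ t * ρ' ^ φ t) ↔ φ t = 1 / 2 := by
  have hc : sqrt ν₀ * Z₁ t ≠ 0 := mul_ne_zero (sqrt_pos.2 hν).ne' hZ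
  rw [powerFamilyB_eq_rpow hρ, powerFamilyB_eq_rpow hρ', mul_right_inj' hc]
  constructor
  · intro h
    by_contra hφ
    exact hne (rpow_left_injOn (sub_ne_zero.2 hφ) hρ.le hρ'.le h)
  · intro h
    rw [h, sub_self, rpow_zero, rpow_zero]

/-- **KERR-COMMON in the family:** where `φ = 1/2`, ALL rungs agree (every pair crosses at that `t`). -/
theorem powerFamilyB_common_crossing (hφ : φ t = 1 / 2) (hρ : 0 < ρ) (hρ' : 0 < ρ') :
    sqrt (ν₀ / ρ) * (Z₁ t * ρ ^ φ t) = sqrt (ν₀ / ρ') * (Z₁ t * ρ' ^ φ t) := by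
  rw [powerFamilyB_eq_rpow hρ, powerFamilyB_eq_rpow hρ', hφ, sub_self, rpow_zero, rpow_zero]

/-- **Crossings transfer between pairs:** if one pair of distinct rungs crosses at `t` (with `Z₁ t ≠ 0`),
every pair crosses at `t`.  Contrapositive: pairwise FAN-OUT of the crossing times is impossible for a
power-law family with a `ρ`-independent exponent — it requires `φ` to depend on `ρ`. -/
theorem powerFamilyB_crossing_transfer (hν : 0 < ν₀) (hρ : 0 < ρ) (hρ' : 0 < ρ') (hne : ρ ≠ ρ')
    (hZ : Z₁ t ≠ 0) (h : sqrt (ν₀ / ρ) * (Z₁ t * ρ ^ φ t) = sqrt (ν₀ / ρ') * (Z₁ t * ρ' ^ φ t)) {σ σ' : ℝ}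
    (hσ : 0 < σ) (hσ' : 0 < σ') : sqrt (ν₀ / σ) * (Z₁ t * σ ^ φ t) = sqrt (ν₀ / σ') * (Z₁ t * σ' ^ φ t) :=
  powerFamilyB_common_crossing ((powerFamilyB_eq_iff hν hρ hρ' hne hZ).1 h) hσ hσ'

/-- **Order of the curves away from a crossing:** for `0 < ρ < ρ'`, `ν₀ > 0` and `Z₁ t > 0`, the LESS
viscous rung `ρ'` is above in `B`-currency iff `1/2 < φ t` (enstrophy growing faster than `√Re`);
it is below iff `φ t < 1/2`.  So a single crossing from "more viscous above" to "less viscous above" is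
the passage of `φ` through `1/2`. -/
theorem powerFamilyB_lt_iff (hν : 0 < ν₀) (hρ : 0 < ρ) (hρρ' : ρ < ρ') (hZ : 0 < Z₁ t) :
    sqrt (ν₀ / ρ) * (Z₁ t * ρ ^ φ t) < sqrt (ν₀ / ρ') * (Z₁ t * ρ' ^ φ t) ↔ 1 / 2 < φ t := by
  have hρ' : 0 < ρ' := hρ.trans hρρ'
  have hc : 0 < sqrt ν₀ * Z₁ t := mul_pos (sqrt_pos.2 hν) hZ
  rw [powerFamilyB_eq_rpow hρ, powerFamilyB_eq_rpow hρ', mul_lt_mul_iff_of_pos_left hc]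
  constructor
  · intro h
    by_contra hle
    rcases (not_lt.1 hle).lt_or_eq with hlt | heq
    · exact (lt_asymm h) (rpow_lt_rpow_of_neg hρ hρρ' (sub_neg.2 hlt))
    · rw [heq, sub_self, rpow_zero, rpow_zero] at h
      exact lt_irrefl _ h
  · intro h
    exact rpow_lt_rpow hρ.le hρρ' (sub_pos.2 h)

/-- The mirror statement: the MORE viscous rung is above iff `φ t < 1/2`. -/
theorem powerFamilyB_gt_iff (hν : 0 < ν₀) (hρ : 0 < ρ) (hρρ' : ρ < ρ') (hZ : 0 < Z₁ t) :
    sqrt (ν₀ / ρ') * (Z₁ t * ρ' ^ φ t) < sqrt (ν₀ / ρ) * (Z₁ t * ρ ^ φ t) ↔ φ t < 1 / 2 := by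
  have hρ' : 0 < ρ' := hρ.trans hρρ'
  have hc : 0 < sqrt ν₀ * Z₁ t := mul_pos (sqrt_pos.2 hν) hZ
  rw [powerFamilyB_eq_rpow hρ, powerFamilyB_eq_rpow hρ', mul_lt_mul_iff_of_pos_left hc]
  constructor
  · intro h
    by_contra hle
    rcases (not_lt.1 hle).lt_or_eq with hlt | heq
    · exact (lt_asymm h) (rpow_lt_rpow hρ.le hρρ' (sub_pos.2 hlt))
    · rw [← heq, sub_self, rpow_zero, rpow_zero] at h
      exact lt_irrefl _ h
  · intro h
    exact rpow_lt_rpow_of_neg hρ hρρ' (sub_neg.2 h)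

end PowerFamily

end Summit.NavierStokesRegularity.FluidComputer.EnstrophyCrossing

end
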